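import Summits.Parity.BatemanHorn.Theorems.AlmostPrimeZerosDiscMajorantLogRealAxisFixedIntervalOfNair
import Summits.Parity.BatemanHorn.Theorems.AlmostPrimeZerosSystemLSDRealSegmentNairMain
import HarnessLib

/-!
# Crux `DiscMajorantLog` (stmt-Parity-17114), line `Sketch`: the positive real segment on fixed
intervals, for EVERY Bateman–Horn system (composition stub `stub_realAxisFixedInterval`)

Crux `Summit.Parity.BatemanHorn.Theses.AlmostPrimeZeros.DiscMajorantLog` asks, for every
Bateman–Horn system `f = (f_1,…,f_k)`, `‖Σ_{n≤x} z^{s_f(n)}‖ ≤ A·x·(log x)^{k(Re z−1)}·e^{C‖z−1‖log(‖z−1‖+2)}`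
on the growing disc `‖z − 1‖ ≤ 3 log log x` (`s_f(n) = Σ_i Σ_{p^v ∥ f_i(n)} min(v,2)`).  On the positive
real axis `z = t` no cancellation is asked, and on every FIXED interval `0 < t ≤ T` the bound holds for
ALL systems:

  `Σ_{0≤n≤x} t^{s_f(n)} ≤ A·x·(log x)^{k(t−1)}`   (`x ≥ x₀(f, T)`, uniformly in `0 < t ≤ T`).

This is the registered composition stub `stub_realAxisFixedInterval` of the line's skeleton
(`Cruxes/DiscMajorantLog/Lines/Sketch.lean`, rev 2: `rightHalf_of_stubs` ⟸ R-fixed ∧ R-growing ∧ A),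
obtained BY NAME from

* `stub_realAxisFixedIntervalOfNair` (this line, p149065): the reduction to Nair–Tenenbaum "light" along
  the shifted product polynomial `(∏ f_i)(X + n₀)` with the weights `t^{Σ_p min(v_p, 2k)}` (`t ≥ 1`) and
  `t^{ω}` (`t < 1`), and two-sided Mertens along the system;
* `nairTenenbaumLight` (sibling crux stmt-Parity-11292, lead c8, `…SystemLSDRealSegmentNairMain.lean`):
  `Σ_{1≤n≤N} G(F(n)) ≤ C·N·exp(Σ_{p≤N} (G(p) − 1)ρ_F(p)/p)` for every multiplicative `G ≥ 0` bounded by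
  `A` on prime powers, the constant `C = C(F, D, M, A)` being chosen BEFORE `G` — which is what makes
  the bound uniform in `t ≤ T`.

References: M. Nair, Acta Arith. 62 (1992); M. Nair, G. Tenenbaum, Acta Math. 180 (1998), Thm 1;
P. Shiu, J. reine angew. Math. 313 (1980).
-/

noncomputable section

namespace Summit.Parity.BatemanHorn.Cruxes.DiscMajorantLog.Sketch

open scoped BigOperators

/-- **Composition stub R-fixed (registered `stub_realAxisFixedInterval`): the positive real segment of
`DiscMajorantLog` on every fixed interval, for every Bateman–Horn system.**  For every system `f` and
every `T ≥ 1` there are `A, x₀` with `Σ_{0≤n≤x} t^{s_f(n)} ≤ A·x·(log x)^{k(t−1)}` for all `x ≥ x₀` and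
all `0 < t ≤ T`.  Proof: `stub_realAxisFixedIntervalOfNair nairTenenbaumLight`.
[cite: NairTenenbaum1998, Theorem 1 (bounded-prime-power class)] -/
theorem stub_realAxisFixedInterval :
    ∀ (k : ℕ) (f : Fin k → Polynomial ℤ), Literature.NumberTheory.Sieve.IsBatemanHornSystem f →
      ∀ T : ℝ, 1 ≤ T → ∃ A : ℝ, ∃ x₀ : ℕ, ∀ x : ℕ, x₀ ≤ x → ∀ t : ℝ, 0 < t → t ≤ T →
        (∑ n ∈ Finset.range (x + 1), t ^ (∑ i, (((f i).eval (n : ℤ)).toNat.factorization.sum fun _ v => min v 2))) ≤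
          A * (x : ℝ) * (Real.log (x : ℝ)) ^ ((k : ℝ) * (t - 1)) :=
  stub_realAxisFixedIntervalOfNair
    Summit.Parity.BatemanHorn.Cruxes.SystemLSDRealSegment.BetaThinnedRootKernel.Nair.nairTenenbaumLight

/-- **Named form**: the real segment `0 < t ≤ T` of the crux `DiscMajorantLog` holds for every
Bateman–Horn system and every fixed `T ≥ 1` (no budget factor needed there).
[cite: NairTenenbaum1998, Theorem 1] -/
theorem discMajorantLog_realAxis_fixedInterval {k : ℕ} {f : Fin k → Polynomial ℤ}
    (hf : Literature.NumberTheory.Sieve.IsBatemanHornSystem f) {T : ℝ} (hT : 1 ≤ T) :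
    ∃ A : ℝ, ∃ x₀ : ℕ, ∀ x : ℕ, x₀ ≤ x → ∀ t : ℝ, 0 < t → t ≤ T →
      (∑ n ∈ Finset.range (x + 1), t ^ (∑ i, (((f i).eval (n : ℤ)).toNat.factorization.sum fun _ v => min v 2))) ≤
        A * (x : ℝ) * (Real.log (x : ℝ)) ^ ((k : ℝ) * (t - 1)) :=
  stub_realAxisFixedInterval k f hf T hT

/-- **The real segment of the route's FIXED disc** (`‖z − 1‖ ≤ 3/2`, the only part of the crux the
route's deciding theorem consumes, refuter finding on stmt-Parity-17114): for every Bateman–Horn system,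
`Σ_{0≤n≤x} t^{s_f(n)} ≤ A·x·(log x)^{k(t−1)}` for all `x ≥ x₀` and all `0 < t ≤ 5/2`.
[cite: NairTenenbaum1998, Theorem 1] -/
theorem discMajorantLog_realAxis_fixedDisc {k : ℕ} {f : Fin k → Polynomial ℤ}
    (hf : Literature.NumberTheory.Sieve.IsBatemanHornSystem f) :
    ∃ A : ℝ, ∃ x₀ : ℕ, ∀ x : ℕ, x₀ ≤ x → ∀ t : ℝ, 0 < t → t ≤ 5 / 2 →
      (∑ n ∈ Finset.range (x + 1), t ^ (∑ i, (((f i).eval (n : ℤ)).toNat.factorization.sum fun _ v => min v 2))) ≤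
        A * (x : ℝ) * (Real.log (x : ℝ)) ^ ((k : ℝ) * (t - 1)) :=
  stub_realAxisFixedInterval k f hf (5 / 2) (by norm_num)

end Summit.Parity.BatemanHorn.Cruxes.DiscMajorantLog.Sketch

end
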